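import Summits.Ventures.PercRepro.RLSRuleOneLineSixGeom

/-!
# C-025 at q = 3: the `6`-point plane with one `3`-point line — the supply in abstract witness sums (night-3, gen 4)

* `oneLineSix_supply` — the profile accounting of `ℓ ∪ {a, b, c}` with the line charged its `(L3)` loss on every
  subset through it (`Λ = {ℓ}`, one triple `C₀ ⊆ K` whose non-supersets are good witnesses, `|K| = N + 3`):
  `19·T₀ + 3(3T₁ − 3L₁) + 12·4T₁ + 3(9T₂ − 9L₂) + 3·10T₂ + (W − L_W) ≤ Σ_{S ∈ Yq} w⁺(G, S)`;
* `oneLineSix_supply_free` — the same with no loss (`Λ = ∅`: no coplanar triple of `ℓ` in `K`):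
  `19·T₀ + 57·T₁ + 57·T₂ + W ≤ Σ_{S ∈ Yq} w⁺(G, S)`.
The types are closed in `RLSRuleOneLineSix`.  Imports `RLSRuleOneLineSixGeom`.  Axioms: standard.
-/

open scoped Matroid

namespace PercRepro

namespace NightThree

open Finset ThmH PerFlat

variable {α : Type*} [DecidableEq α] {M : Matroid α} [M.Finite]

/-! ### The accounting in abstract witness sums -/

open scoped Classical in
/-- **The profile accounting of `ℓ ∪ {a, b, c}`, the line charged** (`Λ = {ℓ}`, one triple `C₀ ⊆ K` whose
non-supersets are good witnesses): `19·T₀ + 3(3T₁ − 3L₁) + 12·4T₁ + 3(9T₂ − 9L₂) + 3·10T₂ + (W − L_W)`. -/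
theorem oneLineSix_supply {p : ℕ} (hc : Core M p) {G ℓ K C₀ : Finset α} {n N : ℕ} (hG : G ∈ flatsQ M 3)
    (h : OneLine M G ℓ) (hGc : G.card = 6) (hKsub : K ⊆ gr M \ G) (hKind : M.Indep (K : Set α))
    (hK : K.card = N + 3) (hn : 2 ≤ n) (hC₀ : C₀ ⊆ K) (hC₀c : C₀.card = 3)
    (hgood : ∀ X, ¬ C₀ ⊆ X → GoodWitness M ℓ K X) :
    19 * (∑ X ∈ witnessFamily K n, 1 / (((3 + X.card).choose 3 : ℕ) : ℚ))
    + 3 * (∑ X ∈ witnessFamily K n, 3 / (((4 + X.card).choose 3 : ℕ) : ℚ)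
        - ∑ j ∈ range (n - 2), (N.choose j : ℚ) * (3 / (((4 + (j + 3)).choose 3 : ℕ) : ℚ)))
    + 12 * (∑ X ∈ witnessFamily K n, 4 / (((4 + X.card).choose 3 : ℕ) : ℚ))
    + 3 * (∑ X ∈ witnessFamily K n, 9 / (((5 + X.card).choose 3 : ℕ) : ℚ)
        - ∑ j ∈ range (n - 2), (N.choose j : ℚ) * (9 / (((5 + (j + 3)).choose 3 : ℕ) : ℚ)))
    + 3 * (∑ X ∈ witnessFamily K n, 10 / (((5 + X.card).choose 3 : ℕ) : ℚ))
    + (∑ _X ∈ witnessFamily K n, (1 : ℚ) - ∑ j ∈ range (n - 2), (N.choose j : ℚ) * (1 : ℚ))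
    ≤ ∑ S ∈ Yq M (n + 4) 3, wPlus M G S := by
  obtain ⟨hmem3, h𝔅rank, hd34, hd5, hd6, hc3, hc4, hc5⟩ := oneLineSix_family hc hG h hGc
  obtain ⟨hℓG, hℓc, hℓr, hone⟩ := h
  have h' : OneLine M G ℓ := ⟨hℓG, hℓc, hℓr, hone⟩
  have hdep : depTriples M G = {ℓ} := depTriples_eq_singleton_of_oneLine h'
  -- the assembly
  have hsup := supply_ge_profile hc hG hKsub hKind n ({ℓ} : Finset (Finset α))
    (fun ℓ' hℓ' hnot => by rw [hdep] at hℓ'; exact absurd hℓ' hnot) (fun _ => C₀)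
    (fun ℓ' hℓ' X hX => by rw [Finset.mem_singleton] at hℓ'; rw [hℓ']; exact hgood X hX) h𝔅rank
  refine le_trans ?_ hsup
  -- the share function on each piece
  set f : Finset α → Finset α → ℚ := fun B X =>
    if ∀ ℓ' ∈ ({ℓ} : Finset (Finset α)), ℓ' ⊆ B → ¬ (fun _ => C₀) ℓ' ⊆ X then profileShare M B X else 0 with hf
  have hcond : ∀ B X, (∀ ℓ' ∈ ({ℓ} : Finset (Finset α)), ℓ' ⊆ B → ¬ (fun _ => C₀) ℓ' ⊆ X) ↔ (ℓ ⊆ B → ¬ C₀ ⊆ X) := by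
    intro B X
    simp only [Finset.mem_singleton, forall_eq]
  have hC : ∀ ℓ' ∈ ({ℓ} : Finset (Finset α)), (fun _ => C₀) ℓ' ⊆ K ∧ ((fun _ => C₀) ℓ').card = 3 :=
    fun _ _ => ⟨hC₀, hC₀c⟩
  -- the triples
  have h3 : ∑ B ∈ (G.powersetCard 3).erase ℓ, ∑ X ∈ witnessFamily K n, f B X =
      19 * (∑ X ∈ witnessFamily K n, 1 / (((3 + X.card).choose 3 : ℕ) : ℚ)) := by
    have hval : ∀ B ∈ (G.powersetCard 3).erase ℓ, ∑ X ∈ witnessFamily K n, f B X =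
        ∑ X ∈ witnessFamily K n, 1 / (((3 + X.card).choose 3 : ℕ) : ℚ) := by
      intro B hB
      obtain ⟨hBG, hBc, hl, _⟩ := hmem3 B hB
      apply Finset.sum_congr rfl
      intro X _
      rw [hf]
      dsimp only
      rw [if_pos ((hcond B X).2 (fun hl' => absurd hl' hl))]
      unfold profileShare
      rw [if_pos (by omega), rho3_of_oneLine h' hBG, hBc]
      simp only [if_neg hl, Nat.choose_self, Nat.sub_zero, Nat.cast_one]
    rw [Finset.sum_congr rfl hval, Finset.sum_const, hc3, nsmul_eq_mul]
    norm_num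
  -- the `4`-subsets
  have h4 : ∑ B ∈ G.powersetCard 4, ∑ X ∈ witnessFamily K n, f B X =
      3 * (∑ X ∈ witnessFamily K n, (if ∀ ℓ' ∈ ({ℓ} : Finset (Finset α)), ¬ (fun _ => C₀) ℓ' ⊆ X then
          (fun x => 3 / (((4 + x).choose 3 : ℕ) : ℚ)) X.card else 0))
      + 12 * (∑ X ∈ witnessFamily K n, 4 / (((4 + X.card).choose 3 : ℕ) : ℚ)) := by
    apply sum_powersetCard_four_six hℓG hℓc hGc
    · intro B hB hl
      obtain ⟨hBG, hBc⟩ := Finset.mem_powersetCard.1 hB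
      apply Finset.sum_congr rfl
      intro X _
      rw [hf]
      dsimp only
      have hc' : (∀ ℓ' ∈ ({ℓ} : Finset (Finset α)), ℓ' ⊆ B → ¬ C₀ ⊆ X) ↔
          (∀ ℓ' ∈ ({ℓ} : Finset (Finset α)), ¬ C₀ ⊆ X) := by
        simp only [Finset.mem_singleton, forall_eq]
        exact ⟨fun h => h hl, fun h _ => h⟩
      by_cases hgd : ∀ ℓ' ∈ ({ℓ} : Finset (Finset α)), ¬ C₀ ⊆ X
      · rw [if_pos (hc'.2 hgd), if_pos hgd]
        unfold profileShare
        rw [if_pos (by omega), rho3_of_oneLine h' hBG, hBc, show Nat.choose 4 3 = 4 by norm_num [Nat.choose]]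
        simp only [if_pos hl]
        norm_num
      · rw [if_neg (fun h => hgd (hc'.1 h)), if_neg hgd]
    · intro B hB hl
      obtain ⟨hBG, hBc⟩ := Finset.mem_powersetCard.1 hB
      apply Finset.sum_congr rfl
      intro X _
      rw [hf]
      dsimp only
      rw [if_pos ((hcond B X).2 (fun hl' => absurd hl' hl))]
      unfold profileShare
      rw [if_pos (by omega), rho3_of_oneLine h' hBG, hBc, show Nat.choose 4 3 = 4 by norm_num [Nat.choose]]
      simp only [if_neg hl, Nat.sub_zero]
      norm_num
  -- the `5`-subsets
  have h5 : ∑ B ∈ G.powersetCard 5, ∑ X ∈ witnessFamily K n, f B X =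
      3 * (∑ X ∈ witnessFamily K n, (if ∀ ℓ' ∈ ({ℓ} : Finset (Finset α)), ¬ (fun _ => C₀) ℓ' ⊆ X then
          (fun x => 9 / (((5 + x).choose 3 : ℕ) : ℚ)) X.card else 0))
      + 3 * (∑ X ∈ witnessFamily K n, 10 / (((5 + X.card).choose 3 : ℕ) : ℚ)) := by
    apply sum_powersetCard_five_six hℓG hℓc hGc
    · intro B hB hl
      obtain ⟨hBG, hBc⟩ := Finset.mem_powersetCard.1 hB
      apply Finset.sum_congr rfl
      intro X _
      rw [hf]
      dsimp only
      have hc' : (∀ ℓ' ∈ ({ℓ} : Finset (Finset α)), ℓ' ⊆ B → ¬ C₀ ⊆ X) ↔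
          (∀ ℓ' ∈ ({ℓ} : Finset (Finset α)), ¬ C₀ ⊆ X) := by
        simp only [Finset.mem_singleton, forall_eq]
        exact ⟨fun h => h hl, fun h _ => h⟩
      by_cases hgd : ∀ ℓ' ∈ ({ℓ} : Finset (Finset α)), ¬ C₀ ⊆ X
      · rw [if_pos (hc'.2 hgd), if_pos hgd]
        unfold profileShare
        rw [if_pos (by omega), rho3_of_oneLine h' hBG, hBc, show Nat.choose 5 3 = 10 by norm_num [Nat.choose]]
        simp only [if_pos hl]
        norm_num
      · rw [if_neg (fun h => hgd (hc'.1 h)), if_neg hgd]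
    · intro B hB hl
      obtain ⟨hBG, hBc⟩ := Finset.mem_powersetCard.1 hB
      apply Finset.sum_congr rfl
      intro X _
      rw [hf]
      dsimp only
      rw [if_pos ((hcond B X).2 (fun hl' => absurd hl' hl))]
      unfold profileShare
      rw [if_pos (by omega), rho3_of_oneLine h' hBG, hBc, show Nat.choose 5 3 = 10 by norm_num [Nat.choose]]
      simp only [if_neg hl, Nat.sub_zero]
      norm_num
  -- the plane itself: the winner share on its good witnesses
  have h6 : ∑ X ∈ witnessFamily K n, f G X =
      ∑ X ∈ witnessFamily K n, (if ∀ ℓ' ∈ ({ℓ} : Finset (Finset α)), ¬ (fun _ => C₀) ℓ' ⊆ X then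
        (fun _ => (1 : ℚ)) X.card else 0) := by
    apply Finset.sum_congr rfl
    intro X _
    rw [hf]
    dsimp only
    have hc' : (∀ ℓ' ∈ ({ℓ} : Finset (Finset α)), ℓ' ⊆ G → ¬ C₀ ⊆ X) ↔
        (∀ ℓ' ∈ ({ℓ} : Finset (Finset α)), ¬ C₀ ⊆ X) := by
      simp only [Finset.mem_singleton, forall_eq]
      exact ⟨fun h => h hℓG, fun h _ => h⟩
    by_cases hgd : ∀ ℓ' ∈ ({ℓ} : Finset (Finset α)), ¬ C₀ ⊆ X
    · rw [if_pos (hc'.2 hgd), if_pos hgd]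
      unfold profileShare
      rw [if_neg (by omega)]
    · rw [if_neg (fun h => hgd (hc'.1 h)), if_neg hgd]
  -- the union bounds for the charged pieces
  have hb4 := sum_good_ge_sub hn hK ({ℓ} : Finset (Finset α)) (fun _ => C₀) hC
    (fun x => 3 / (((4 + x).choose 3 : ℕ) : ℚ)) (fun _ => by positivity)
  have hb5 := sum_good_ge_sub hn hK ({ℓ} : Finset (Finset α)) (fun _ => C₀) hC
    (fun x => 9 / (((5 + x).choose 3 : ℕ) : ℚ)) (fun _ => by positivity)
  have hb6 := sum_good_ge_sub hn hK ({ℓ} : Finset (Finset α)) (fun _ => C₀) hC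
    (fun _ => (1 : ℚ)) (fun _ => by positivity)
  rw [Finset.card_singleton, Nat.cast_one, one_mul] at hb4 hb5 hb6
  rw [Finset.sum_union hd6, Finset.sum_union hd5, Finset.sum_union hd34, Finset.sum_singleton, h3, h4, h5, h6]
  linarith

open scoped Classical in
/-- **The profile accounting of `ℓ ∪ {a, b, c}` with no loss** (`Λ = ∅`: no coplanar triple of `ℓ` in `K`):
`19·T₀ + 57·T₁ + 57·T₂ + W` in the witness sums of `K`. -/
theorem oneLineSix_supply_free {p : ℕ} (hc : Core M p) {G ℓ K : Finset α} {n : ℕ} (hG : G ∈ flatsQ M 3)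
    (h : OneLine M G ℓ) (hGc : G.card = 6) (hKsub : K ⊆ gr M \ G) (hKind : M.Indep (K : Set α))
    (hemp : coplanarTriples M ℓ K = ∅) :
    19 * (∑ X ∈ witnessFamily K n, 1 / (((3 + X.card).choose 3 : ℕ) : ℚ))
    + 57 * (∑ X ∈ witnessFamily K n, 1 / (((4 + X.card).choose 3 : ℕ) : ℚ))
    + 57 * (∑ X ∈ witnessFamily K n, 1 / (((5 + X.card).choose 3 : ℕ) : ℚ))
    + (∑ _X ∈ witnessFamily K n, (1 : ℚ))
    ≤ ∑ S ∈ Yq M (n + 4) 3, wPlus M G S := by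
  obtain ⟨hmem3, h𝔅rank, hd34, hd5, hd6, hc3, hc4, hc5⟩ := oneLineSix_family hc hG h hGc
  obtain ⟨hℓG, hℓc, hℓr, hone⟩ := h
  have h' : OneLine M G ℓ := ⟨hℓG, hℓc, hℓr, hone⟩
  have hdep : depTriples M G = {ℓ} := depTriples_eq_singleton_of_oneLine h'
  have hsup := supply_ge_profile hc hG hKsub hKind n (∅ : Finset (Finset α))
    (fun ℓ' hℓ' _ => by rw [hdep, Finset.mem_singleton] at hℓ'; rw [hℓ']; exact hemp) (fun _ => ∅)
    (fun ℓ' hℓ' => absurd hℓ' (Finset.notMem_empty ℓ')) h𝔅rank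
  refine le_trans ?_ hsup
  have hval : ∀ B X, (if ∀ ℓ' ∈ (∅ : Finset (Finset α)), ℓ' ⊆ B → ¬ (fun _ => (∅ : Finset α)) ℓ' ⊆ X then
      profileShare M B X else 0) = profileShare M B X := by
    intro B X
    rw [if_pos (fun ℓ' hℓ' => absurd hℓ' (Finset.notMem_empty ℓ'))]
  simp only [hval]
  have h3 : ∑ B ∈ (G.powersetCard 3).erase ℓ, ∑ X ∈ witnessFamily K n, profileShare M B X =
      19 * (∑ X ∈ witnessFamily K n, 1 / (((3 + X.card).choose 3 : ℕ) : ℚ)) := by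
    have hv : ∀ B ∈ (G.powersetCard 3).erase ℓ, ∑ X ∈ witnessFamily K n, profileShare M B X =
        ∑ X ∈ witnessFamily K n, 1 / (((3 + X.card).choose 3 : ℕ) : ℚ) := by
      intro B hB
      obtain ⟨hBG, hBc, hl, _⟩ := hmem3 B hB
      apply Finset.sum_congr rfl
      intro X _
      unfold profileShare
      rw [if_pos (by omega), rho3_of_oneLine h' hBG, hBc]
      simp only [if_neg hl, Nat.choose_self, Nat.sub_zero, Nat.cast_one]
    rw [Finset.sum_congr rfl hv, Finset.sum_const, hc3, nsmul_eq_mul]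
    norm_num
  have h4 : ∑ B ∈ G.powersetCard 4, ∑ X ∈ witnessFamily K n, profileShare M B X =
      3 * (∑ X ∈ witnessFamily K n, 3 / (((4 + X.card).choose 3 : ℕ) : ℚ))
      + 12 * (∑ X ∈ witnessFamily K n, 4 / (((4 + X.card).choose 3 : ℕ) : ℚ)) := by
    apply sum_powersetCard_four_six hℓG hℓc hGc
    · intro B hB hl
      obtain ⟨hBG, hBc⟩ := Finset.mem_powersetCard.1 hB
      apply Finset.sum_congr rfl
      intro X _
      unfold profileShare
      rw [if_pos (by omega), rho3_of_oneLine h' hBG, hBc, show Nat.choose 4 3 = 4 by norm_num [Nat.choose]]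
      simp only [if_pos hl]
      norm_num
    · intro B hB hl
      obtain ⟨hBG, hBc⟩ := Finset.mem_powersetCard.1 hB
      apply Finset.sum_congr rfl
      intro X _
      unfold profileShare
      rw [if_pos (by omega), rho3_of_oneLine h' hBG, hBc, show Nat.choose 4 3 = 4 by norm_num [Nat.choose]]
      simp only [if_neg hl, Nat.sub_zero]
      norm_num
  have h5 : ∑ B ∈ G.powersetCard 5, ∑ X ∈ witnessFamily K n, profileShare M B X =
      3 * (∑ X ∈ witnessFamily K n, 9 / (((5 + X.card).choose 3 : ℕ) : ℚ))
      + 3 * (∑ X ∈ witnessFamily K n, 10 / (((5 + X.card).choose 3 : ℕ) : ℚ)) := by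
    apply sum_powersetCard_five_six hℓG hℓc hGc
    · intro B hB hl
      obtain ⟨hBG, hBc⟩ := Finset.mem_powersetCard.1 hB
      apply Finset.sum_congr rfl
      intro X _
      unfold profileShare
      rw [if_pos (by omega), rho3_of_oneLine h' hBG, hBc, show Nat.choose 5 3 = 10 by norm_num [Nat.choose]]
      simp only [if_pos hl]
      norm_num
    · intro B hB hl
      obtain ⟨hBG, hBc⟩ := Finset.mem_powersetCard.1 hB
      apply Finset.sum_congr rfl
      intro X _
      unfold profileShare
      rw [if_pos (by omega), rho3_of_oneLine h' hBG, hBc, show Nat.choose 5 3 = 10 by norm_num [Nat.choose]]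
      simp only [if_neg hl, Nat.sub_zero]
      norm_num
  have h6 : ∑ X ∈ witnessFamily K n, profileShare M G X = ∑ _X ∈ witnessFamily K n, (1 : ℚ) := by
    apply Finset.sum_congr rfl
    intro X _
    unfold profileShare
    rw [if_neg (by omega)]
  rw [Finset.sum_union hd6, Finset.sum_union hd5, Finset.sum_union hd34, Finset.sum_singleton, h3, h4, h5, h6]
  have e1 : ∑ X ∈ witnessFamily K n, 3 / (((4 + X.card).choose 3 : ℕ) : ℚ) =
      3 * ∑ X ∈ witnessFamily K n, 1 / (((4 + X.card).choose 3 : ℕ) : ℚ) := by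
    rw [Finset.mul_sum]; apply Finset.sum_congr rfl; intro X _; ring
  have e2 : ∑ X ∈ witnessFamily K n, 4 / (((4 + X.card).choose 3 : ℕ) : ℚ) =
      4 * ∑ X ∈ witnessFamily K n, 1 / (((4 + X.card).choose 3 : ℕ) : ℚ) := by
    rw [Finset.mul_sum]; apply Finset.sum_congr rfl; intro X _; ring
  have e3 : ∑ X ∈ witnessFamily K n, 9 / (((5 + X.card).choose 3 : ℕ) : ℚ) =
      9 * ∑ X ∈ witnessFamily K n, 1 / (((5 + X.card).choose 3 : ℕ) : ℚ) := by
    rw [Finset.mul_sum]; apply Finset.sum_congr rfl; intro X _; ring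
  have e4 : ∑ X ∈ witnessFamily K n, 10 / (((5 + X.card).choose 3 : ℕ) : ℚ) =
      10 * ∑ X ∈ witnessFamily K n, 1 / (((5 + X.card).choose 3 : ℕ) : ℚ) := by
    rw [Finset.mul_sum]; apply Finset.sum_congr rfl; intro X _; ring
  rw [e1, e2, e3, e4]
  linarith


end NightThree

end PercRepro
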